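import Summits.CriticalPhenomena.PercolationContinuityZ3.Theorems.PercNearOneGluingNoHeavyLowerTailFibreSwitchingTerminalTypes
import HarnessLib

/-!
# `NoHeavyLowerTail` (stmt-CriticalPhenomena-4575) — TERMINAL-EDGE CLOSURE of three-copy fibre positivity of `H_{q+t}`, II: the theorem

Support file (new-inequality factory seat `prim-ineq-gen-1`, gen 6; `--supports stmt-CriticalPhenomena-4575`).  No named facts, no sorries.
Part I is `…FibreSwitchingTerminalTypes` (poset `M3`, kernels `ag/agm/hq`, step kernels `K1/K2`, certificates `cert_one/cert_two`,
`code_insert_ab`, `codeM3_mono`).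

**Theorem (`hqt_fibre_nonneg_insert_terminal_edge`).**  Let `a ≠ b`, `c` be vertices and `s(a,b) ∉ D`.  If
`0 ≤ Σ_{y ∈ fibre D k'} hqtKernel (code y₀) (code y₁) (code y₂)` for every profile `k'` (three-copy fibre positivity of
`H_{q+t}` for the coordinates `D`, the factory's `R2 = M(HQT)` restricted to `D`), then the same holds for `insert s(a,b) D` and
every profile: adding an edge between two TERMINALS preserves `M(HQT)` (FINDING-12 §2; so a minimal counterexample to `R2` has no
terminal–terminal edge).  Proof: coordinate splitting (`FibreSplit.sum_fibre_insert`), the type of the copies holding the new edge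
is `joinPc` of the old type (`code_insert_ab`), multiplicities `0/3` are the hypothesis / identically zero, multiplicities `1/2`
follow from the pointwise certificates `6·hq + Σ_π env₁∘π ≤ 6·K1`, `Σ_π env₂∘π ≤ 6·K2` (`decide`), the copy-symmetry of fibres
(`sum_fibre_sym6`) and the environment decomposition (`FibreEnv.sum_fibre_env_kernel_nonneg` with the monotone type `codeM3`
and the chain-nonnegative submodular kernels `ag`, `agm`).
-/

namespace Summit.CriticalPhenomena.PercolationContinuityZ3.Theorems

namespace FibreTermEdge

open Finset FibreSwitching FibreEnv FibreSplit FibreSHK3 ThreeCopy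
open Literature.Probability.Percolation Literature.Probability.Percolation.DecisionTree
open Literature.Probability.Percolation.Gladkov

noncomputable section

open Classical

/-! ### Assembly -/

section Main

variable {V : Type*} [Fintype V] [DecidableEq V]

/-- `(0 1)` on `Fin 3`. [folklore] -/
private theorem u01_0 : (Equiv.swap (0 : Fin 3) 1) 0 = 1 := by decide
/-- `(0 1)` on `Fin 3`. [folklore] -/
private theorem u01_1 : (Equiv.swap (0 : Fin 3) 1) 1 = 0 := by decide
/-- `(0 1)` on `Fin 3`. [folklore] -/
private theorem u01_2 : (Equiv.swap (0 : Fin 3) 1) 2 = 2 := by decide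
/-- `(0 2)` on `Fin 3`. [folklore] -/
private theorem u02_0 : (Equiv.swap (0 : Fin 3) 2) 0 = 2 := by decide
/-- `(0 2)` on `Fin 3`. [folklore] -/
private theorem u02_1 : (Equiv.swap (0 : Fin 3) 2) 1 = 1 := by decide
/-- `(0 2)` on `Fin 3`. [folklore] -/
private theorem u02_2 : (Equiv.swap (0 : Fin 3) 2) 2 = 0 := by decide
/-- `(1 2)` on `Fin 3`. [folklore] -/
private theorem u12_0 : (Equiv.swap (1 : Fin 3) 2) 0 = 0 := by decide
/-- `(1 2)` on `Fin 3`. [folklore] -/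
private theorem u12_1 : (Equiv.swap (1 : Fin 3) 2) 1 = 2 := by decide
/-- `(1 2)` on `Fin 3`. [folklore] -/
private theorem u12_2 : (Equiv.swap (1 : Fin 3) 2) 2 = 1 := by decide
/-- The 3-cycle `(0 1)(1 2)`. [folklore] -/
private theorem ur_0 : ((Equiv.swap (0 : Fin 3) 1).trans (Equiv.swap 1 2)) 0 = 2 := by decide
/-- The 3-cycle `(0 1)(1 2)`. [folklore] -/
private theorem ur_1 : ((Equiv.swap (0 : Fin 3) 1).trans (Equiv.swap 1 2)) 1 = 0 := by decide
/-- The 3-cycle `(0 1)(1 2)`. [folklore] -/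
private theorem ur_2 : ((Equiv.swap (0 : Fin 3) 1).trans (Equiv.swap 1 2)) 2 = 1 := by decide
/-- The 3-cycle `(1 2)(0 1)`. [folklore] -/
private theorem ur'_0 : ((Equiv.swap (1 : Fin 3) 2).trans (Equiv.swap 0 1)) 0 = 1 := by decide
/-- The 3-cycle `(1 2)(0 1)`. [folklore] -/
private theorem ur'_1 : ((Equiv.swap (1 : Fin 3) 2).trans (Equiv.swap 0 1)) 1 = 2 := by decide
/-- The 3-cycle `(1 2)(0 1)`. [folklore] -/
private theorem ur'_2 : ((Equiv.swap (1 : Fin 3) 2).trans (Equiv.swap 0 1)) 2 = 0 := by decide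

omit [Fintype V] in
/-- Fibre sum of a copy-symmetrised function = six times the fibre sum. [this work] -/
theorem sum_fibre_sym6 (D : Finset (Sym2 V)) (k : Sym2 V → ℕ) (F : Fin 5 → Fin 5 → Fin 5 → ℤ)
    (cd : Finset (Sym2 V) → Fin 5) :
    ∑ y ∈ fibre D k, (sym6 F (cd (y 0)) (cd (y 1)) (cd (y 2)) : ℝ) =
      6 * ∑ y ∈ fibre D k, (F (cd (y 0)) (cd (y 1)) (cd (y 2)) : ℝ) := by
  set g : (Fin 3 → Finset (Sym2 V)) → ℝ := fun y => (F (cd (y 0)) (cd (y 1)) (cd (y 2)) : ℝ) with hg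
  have e01 := sum_fibre_comp_perm D (Equiv.swap 0 1) k g
  have e02 := sum_fibre_comp_perm D (Equiv.swap 0 2) k g
  have e12 := sum_fibre_comp_perm D (Equiv.swap 1 2) k g
  have er := sum_fibre_comp_perm D ((Equiv.swap 0 1).trans (Equiv.swap 1 2)) k g
  have er' := sum_fibre_comp_perm D ((Equiv.swap 1 2).trans (Equiv.swap 0 1)) k g
  simp only [hg, u01_0, u01_1, u01_2, u02_0, u02_1, u02_2, u12_0, u12_1, u12_2, ur_0, ur_1, ur_2,
    ur'_0, ur'_1, ur'_2] at e01 e02 e12 er er'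
  have : ∀ y : Fin 3 → Finset (Sym2 V), (sym6 F (cd (y 0)) (cd (y 1)) (cd (y 2)) : ℝ) =
      (F (cd (y 0)) (cd (y 1)) (cd (y 2)) : ℝ) + (F (cd (y 1)) (cd (y 0)) (cd (y 2)) : ℝ)
      + (F (cd (y 2)) (cd (y 1)) (cd (y 0)) : ℝ) + (F (cd (y 0)) (cd (y 2)) (cd (y 1)) : ℝ)
      + (F (cd (y 2)) (cd (y 0)) (cd (y 1)) : ℝ) + (F (cd (y 1)) (cd (y 2)) (cd (y 0)) : ℝ) := by
    intro y; simp only [sym6]; push_cast; ring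
  rw [sum_congr rfl fun y _ => this y]
  simp only [sum_add_distrib]
  rw [e01, e02, e12, er, er']
  ring

omit [Fintype V] in
/-- The two environment-conditioned Gladkov sums are nonnegative on every fibre (environment decomposition). [this work] -/
theorem sum_fibre_env1_nonneg (a b c : V) (D : Finset (Sym2 V)) (k : Sym2 V → ℕ) :
    0 ≤ ∑ y ∈ fibre D k, (env1 (code a b c (y 0)) (code a b c (y 1)) (code a b c (y 2)) : ℝ) := by
  have h1 := sum_fibre_env_kernel_nonneg D k (codeM3 a b c) (fun X Y hXY => codeM3_mono a b c hXY)
    (fun p q : M3 => (ag p.v q.v : ℝ)) (fun p q hpq => by exact_mod_cast ag_chain p q hpq)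
    (fun a₀ a₁ b₀ b₁ h h' => by exact_mod_cast ag_submod a₀ a₁ b₀ b₁ h h')
    (fun ω => if code a b c ω = 1 ∨ code a b c ω = 2 then (3 : ℝ) else 0)
    (fun ω => by split_ifs <;> norm_num)
  have h2 := sum_fibre_env_kernel_nonneg D k (codeM3 a b c) (fun X Y hXY => codeM3_mono a b c hXY)
    (fun p q : M3 => (agm p.v q.v : ℝ)) (fun p q hpq => by exact_mod_cast agm_chain p q hpq)
    (fun a₀ a₁ b₀ b₁ h h' => by exact_mod_cast agm_submod a₀ a₁ b₀ b₁ h h')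
    (fun ω => if code a b c ω = 4 then (3 : ℝ) else 0)
    (fun ω => by split_ifs <;> norm_num)
  have hpt : ∀ y : Fin 3 → Finset (Sym2 V),
      (env1 (code a b c (y 0)) (code a b c (y 1)) (code a b c (y 2)) : ℝ) =
        (if code a b c (y 2) = 1 ∨ code a b c (y 2) = 2 then (3 : ℝ) else 0) *
            (ag (codeM3 a b c (y 0)).v (codeM3 a b c (y 1)).v : ℝ) +
          (if code a b c (y 2) = 4 then (3 : ℝ) else 0) *
            (agm (codeM3 a b c (y 0)).v (codeM3 a b c (y 1)).v : ℝ) := by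
    intro y
    simp only [env1, codeM3]
    push_cast
    split_ifs <;> ring
  rw [sum_congr rfl fun y _ => hpt y, sum_add_distrib]
  exact add_nonneg h1 h2

omit [Fintype V] in
/-- The same for the multiplicity-2 environment kernel. [this work] -/
theorem sum_fibre_env2_nonneg (a b c : V) (D : Finset (Sym2 V)) (k : Sym2 V → ℕ) :
    0 ≤ ∑ y ∈ fibre D k, (env2 (code a b c (y 0)) (code a b c (y 1)) (code a b c (y 2)) : ℝ) := by
  have h2 := sum_fibre_env_kernel_nonneg D k (codeM3 a b c) (fun X Y hXY => codeM3_mono a b c hXY)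
    (fun p q : M3 => (agm p.v q.v : ℝ)) (fun p q hpq => by exact_mod_cast agm_chain p q hpq)
    (fun a₀ a₁ b₀ b₁ h h' => by exact_mod_cast agm_submod a₀ a₁ b₀ b₁ h h')
    (fun ω => if code a b c ω = 1 ∨ code a b c ω = 2 ∨ code a b c ω = 4 then (3 : ℝ) else 0)
    (fun ω => by split_ifs <;> norm_num)
  have hpt : ∀ y : Fin 3 → Finset (Sym2 V),
      (env2 (code a b c (y 0)) (code a b c (y 1)) (code a b c (y 2)) : ℝ) =
        (if code a b c (y 2) = 1 ∨ code a b c (y 2) = 2 ∨ code a b c (y 2) = 4 then (3 : ℝ) else 0) *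
            (agm (codeM3 a b c (y 0)).v (codeM3 a b c (y 1)).v : ℝ) := by
    intro y
    simp only [env2, codeM3]
    push_cast
    split_ifs <;> ring
  rw [sum_congr rfl fun y _ => hpt y]
  exact h2

/-- `sizeSets` for the four possible multiplicities (and empty beyond). [this work] -/
theorem sizeSets_zero {ι : Type*} {k : ι → ℕ} {e : ι} (h : k e = 0) : sizeSets k e = {∅} := by
  ext R; rw [mem_sizeSets, h]; revert R; decide
/-- See `sizeSets_zero`. [this work] -/
theorem sizeSets_one {ι : Type*} {k : ι → ℕ} {e : ι} (h : k e = 1) : sizeSets k e = {{0}, {1}, {2}} := by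
  ext R; rw [mem_sizeSets, h]; revert R; decide
/-- See `sizeSets_zero`. [this work] -/
theorem sizeSets_two {ι : Type*} {k : ι → ℕ} {e : ι} (h : k e = 2) :
    sizeSets k e = {{0, 1}, {0, 2}, {1, 2}} := by
  ext R; rw [mem_sizeSets, h]; revert R; decide
/-- See `sizeSets_zero`. [this work] -/
theorem sizeSets_three {ι : Type*} {k : ι → ℕ} {e : ι} (h : k e = 3) : sizeSets k e = {Finset.univ} := by
  ext R; rw [mem_sizeSets, h]; revert R; decide
/-- See `sizeSets_zero`. [this work] -/
theorem sizeSets_large {ι : Type*} {k : ι → ℕ} {e : ι} (h : 4 ≤ k e) : sizeSets k e = ∅ := by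
  ext R
  rw [mem_sizeSets]
  simp only [Finset.notMem_empty, iff_false]
  have : R.card ≤ 3 := (card_le_univ R).trans (by simp)
  omega

omit [Fintype V] in
/-- **THEOREM (terminal-edge closure of `M(HQT)`).**  For vertices `a ≠ b`, `c` and coordinates `D ∌ s(a,b)`: if every
three-copy fibre sum of the `H_{q+t}` kernel of the types is nonnegative for `D`, then the same holds for `insert s(a,b) D`.
[this work] -/
theorem hqt_fibre_nonneg_insert_terminal_edge {a b : V} (c : V) (hab : a ≠ b) {D : Finset (Sym2 V)}
    (he : s(a, b) ∉ D)
    (IH : ∀ k' : Sym2 V → ℕ,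
      0 ≤ ∑ y ∈ fibre D k', (hq (code a b c (y 0)) (code a b c (y 1)) (code a b c (y 2)) : ℝ))
    (k : Sym2 V → ℕ) :
    0 ≤ ∑ x ∈ fibre (insert s(a, b) D) k, (hq (code a b c (x 0)) (code a b c (x 1)) (code a b c (x 2)) : ℝ) := by
  rw [sum_fibre_insert he k]
  set k₀ := Function.update k s(a, b) 0 with hk₀
  set cd := code a b c with hcd
  -- the type of a copy of `addTo e R y`
  have hty : ∀ y ∈ fibre D k₀, ∀ (R : Finset (Fin 3)) (i : Fin 3),
      cd (addTo s(a, b) R y i) = if i ∈ R then joinPc (cd (y i)) else cd (y i) := by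
    intro y hy R i
    unfold addTo
    by_cases hi : i ∈ R
    · rw [if_pos hi, if_pos hi, hcd, code_insert_ab a b c hab]
    · rw [if_neg hi, if_neg hi]
  obtain h0 | h1 | h2 | h3 | h4 : k s(a, b) = 0 ∨ k s(a, b) = 1 ∨ k s(a, b) = 2 ∨ k s(a, b) = 3 ∨ 4 ≤ k s(a, b) := by
    omega
  · -- multiplicity 0: the hypothesis
    rw [sizeSets_zero h0, sum_singleton]
    have := IH k₀
    refine le_of_le_of_eq this (sum_congr rfl fun y hy => ?_)
    simp only [hty y hy, Finset.notMem_empty, if_false]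
  · -- multiplicity 1: certificate `cert_one`
    rw [sizeSets_one h1, sum_insert (by decide), sum_insert (by decide), sum_singleton]
    have hK1 : ∀ y ∈ fibre D k₀,
        (hq (cd (addTo s(a, b) {0} y 0)) (cd (addTo s(a, b) {0} y 1)) (cd (addTo s(a, b) {0} y 2)) : ℝ) +
        ((hq (cd (addTo s(a, b) {1} y 0)) (cd (addTo s(a, b) {1} y 1)) (cd (addTo s(a, b) {1} y 2)) : ℝ) +
         (hq (cd (addTo s(a, b) {2} y 0)) (cd (addTo s(a, b) {2} y 1)) (cd (addTo s(a, b) {2} y 2)) : ℝ)) =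
        (K1 (cd (y 0)) (cd (y 1)) (cd (y 2)) : ℝ) := by
      intro y hy
      have e0 := hty y hy {0}
      have e1 := hty y hy {1}
      have e2 := hty y hy {2}
      simp only [e0, e1, e2]
      simp [K1]
      all_goals ring
    rw [← sum_add_distrib, ← sum_add_distrib, sum_congr rfl hK1]
    -- 6 Σ K1 ≥ 6 Σ hq + Σ sym6 env1 = 6 IH + 6 Σ env1 ≥ 0
    have hc : ∀ y : Fin 3 → Finset (Sym2 V),
        6 * (hq (cd (y 0)) (cd (y 1)) (cd (y 2)) : ℝ) + (sym6 env1 (cd (y 0)) (cd (y 1)) (cd (y 2)) : ℝ) ≤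
          6 * (K1 (cd (y 0)) (cd (y 1)) (cd (y 2)) : ℝ) := fun y => by
      exact_mod_cast cert_one (cd (y 0)) (cd (y 1)) (cd (y 2))
    have hsum := sum_le_sum fun y (_ : y ∈ fibre D k₀) => hc y
    rw [sum_add_distrib, ← mul_sum, ← mul_sum, sum_fibre_sym6 D k₀ env1 cd] at hsum
    have hI := IH k₀
    have hE := sum_fibre_env1_nonneg a b c D k₀
    rw [← hcd] at hE
    nlinarith
  · -- multiplicity 2: certificate `cert_two`
    rw [sizeSets_two h2, sum_insert (by decide), sum_insert (by decide), sum_singleton]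
    have hK2 : ∀ y ∈ fibre D k₀,
        (hq (cd (addTo s(a, b) {0, 1} y 0)) (cd (addTo s(a, b) {0, 1} y 1)) (cd (addTo s(a, b) {0, 1} y 2)) : ℝ) +
        ((hq (cd (addTo s(a, b) {0, 2} y 0)) (cd (addTo s(a, b) {0, 2} y 1)) (cd (addTo s(a, b) {0, 2} y 2)) : ℝ) +
         (hq (cd (addTo s(a, b) {1, 2} y 0)) (cd (addTo s(a, b) {1, 2} y 1)) (cd (addTo s(a, b) {1, 2} y 2)) : ℝ)) =
        (K2 (cd (y 0)) (cd (y 1)) (cd (y 2)) : ℝ) := by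
      intro y hy
      have e0 := hty y hy {0, 1}
      have e1 := hty y hy {0, 2}
      have e2 := hty y hy {1, 2}
      simp only [e0, e1, e2]
      simp [K2]
      all_goals ring
    rw [← sum_add_distrib, ← sum_add_distrib, sum_congr rfl hK2]
    have hc : ∀ y : Fin 3 → Finset (Sym2 V),
        (sym6 env2 (cd (y 0)) (cd (y 1)) (cd (y 2)) : ℝ) ≤ 6 * (K2 (cd (y 0)) (cd (y 1)) (cd (y 2)) : ℝ) := fun y => by
      exact_mod_cast cert_two (cd (y 0)) (cd (y 1)) (cd (y 2))
    have hsum := sum_le_sum fun y (_ : y ∈ fibre D k₀) => hc y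
    rw [← mul_sum, sum_fibre_sym6 D k₀ env2 cd] at hsum
    have hE := sum_fibre_env2_nonneg a b c D k₀
    rw [← hcd] at hE
    nlinarith
  · -- multiplicity 3: identically zero
    rw [sizeSets_three h3, sum_singleton]
    refine le_of_eq (Eq.symm (sum_eq_zero fun y hy => ?_))
    simp only [hty y hy, Finset.mem_univ, if_true]
    exact_mod_cast hqt_join3 (cd (y 0)) (cd (y 1)) (cd (y 2))
  · -- impossible multiplicity: empty index set
    rw [sizeSets_large h4, sum_empty]

end Main

end

end FibreTermEdge

end Summit.CriticalPhenomena.PercolationContinuityZ3.Theorems
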